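import Mathlib
import Summits.Langlands.Langlands.Theorems.QuadraticWindowHostInducedRepPaneDefs
import Summits.Langlands.Langlands.Theorems.QuadraticWindowHostInducedRepPackageDict
import Summits.Langlands.Langlands.Theorems.QuadraticWindowHostInducedRepPackageHecke
import Summits.Langlands.Langlands.Theorems.QuadraticWindowHostInducedRepMemberArch
import Summits.Langlands.Langlands.Theorems.QuadraticWindowHostInducedRepMemberParity
import Summits.Langlands.Langlands.Theorems.QuadraticWindowHostInducedRepMemberSatakeKlein
import Literature.NumberTheory.Automorphic.AutomorphicInductionCuspidalUnramified
import Literature.NumberTheory.Automorphic.BaseChangeUnramifiedLift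
import Literature.NumberTheory.Automorphic.AdeleBaseChange
import Literature.NumberTheory.QuadraticForms.QuadraticExtensionPlaces

/-!
# Sub-stub `stub_memberSatake` of the member statement (stub `stub_package`, line
# `one-transparent-pane`, crux `Summit.Langlands.Langlands.Theses.QuadraticWindow.HostInducedRep`,
# item stmt-Langlands-10902) — helper file 2: the member OBJECTS and their relations `MemberRel`

LOG (wave-3 worker `stub_memberSatake`, 2026-08-16).  No definition, no new fact: the three facts of
the sub-stub (`hAI` = `automorphicInduction_cyclic_cuspidal_unramified`, the placewise cuspidal base
change `hBC`, the extension of unitary idele class characters `hext`) are HYPOTHESES of the theorem.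

`memberSatake_objects`: for the crux data (`Hyps`), a quadratic `K/F₀` (involution `cK`) ramified at a
guarded place `v₀`, a pane tower `L`, the Artin avatars `χe, ω` (with `ω₀ = ω|_{F₀}`) and an admissible
`μ`, the objects
* `χ₀ := (χe ω₀)⁻¹ μ` (finite order, hence unitary), `ψu :=` the unitary extension of `χ₀` to `K`
  given by `hext` on the set `U = {u : χ₀ unramified below u} ∪ {the chosen place over v : v split}`
  (`cK`-admissible: a chosen place is never the conjugate of a chosen place),
* `νk = ‖·‖_K^{k/2}`, `ν = ‖·‖_K^{-n/2}` (`exists_heckeCharacter_ideleNorm_cpow`),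
* `Pind := AI_{F/F₀}(π ⊗ ω)` (`hAI` on the non-Galois-stable twist, relation at EVERY place unramified
  in `F`, in particular at every guarded place — as in `stub_inducedPackage_of_automorphicInduction`,
  but with the GIVEN avatar `ω`), `PiK := BC_{K/F₀}(Pind)` (`hBC`: `Pind` is unramified at the ramified
  guarded `v₀`), `τ' := PiK ⊗ (ψu νk)` (`exists_cuspidalAutomorphicRepData_twist_hecke`),
* `P₀ := BC_{L/F}(π ⊗ ω)` (`hBC`: the place `w₀ = 𝔓₀ ∩ F` below a place `𝔓₀` of `L` over `v₀` is
  ramified in `L` — `e(𝔓₀|v₀) = e(w₀|v₀) e(𝔓₀|w₀) = e(u₀|v₀) e(𝔓₀|u₀)` with `e(w₀|v₀) = 1` (guard) and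
  `e(u₀|v₀) = 2` — and `π ⊗ ω` is unramified at `w₀`), `P := P₀ ⊗ ((ψu νk) ∘ N_{L/K})`,
satisfy `MemberRel`, `ψu` is unramified above the unramified places of `χ₀`, and the COVERAGE clause of
the dictionary holds: at the chosen place `u` over every guarded `v` split in `K`, `ψ₁ = ψu νk ν` is
unramified and `τ'` has a Satake parameter `β` with `arithFrobPolyOfSatake ι q_u (2n) (β ψ₁(ϖ_u)⁻¹) =
hostPoly v` (the landed `member_dictionary_split`: induced parameter at `v`, STRONG base change at `u`,
placewise twist).  [cite: ArthurClozelAMS120, Ch. 3 Thm. 4.2, 5.1, 6.2]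
-/

open scoped BigOperators Polynomial Classical
open Filter Set Polynomial IsDedekindDomain NumberField
open Literature.NumberTheory.Automorphic Literature.NumberTheory.GaloisRepresentations
open Literature.NumberTheory.QuadraticForms Literature.NumberTheory.QuadraticForms.QuadraticExtension
open Summit.Langlands.Langlands.Theorems.HostInducedRep.GrsExplicitDescent

-- `Summit.Langlands.Langlands.…` (summit = sub-problem name, D-0017 layout) trips `dupNamespace`.
set_option linter.dupNamespace false

noncomputable section

namespace Summit.Langlands.Langlands.Theorems.HostInducedRep.OneTransparentPane

section Ramified

variable {F₀ F K L : Type} [Field F₀] [NumberField F₀] [Field F] [NumberField F] [Field K]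
  [NumberField K] [Field L] [NumberField L] [Algebra F₀ F] [Algebra F₀ K] [Algebra F₀ L] [Algebra F L]
  [Algebra K L] [IsScalarTower F₀ F L] [IsScalarTower F₀ K L]

/-- **A place of `L` above a place `v₀` of `F₀` unramified in `F` but ramified in the Galois `K` lies
over a place of `F` ramified in `L`**: `e(𝔓|v₀) = e(w|v₀) e(𝔓|w) = e(u|v₀) e(𝔓|u)` with `e(w|v₀) = 1`
and `e(u|v₀) ≠ 1` (in the Galois `K/F₀` all `e(u|v₀)` agree). [folklore] -/
theorem not_isUnramifiedIn_under_of_tower [IsGalois F₀ K] (𝔓 : HeightOneSpectrum (𝓞 L))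
    {v₀ : HeightOneSpectrum (𝓞 F₀)} (h𝔓 : 𝔓.under (𝓞 F₀) = v₀)
    (hv₀ : ¬ Algebra.IsUnramifiedIn (𝓞 K) v₀.asIdeal)
    (hF : ∀ w : HeightOneSpectrum (𝓞 F), w.under (𝓞 F₀) = v₀ → w.asIdeal.ramificationIdx (𝓞 F₀) = 1) :
    ¬ Algebra.IsUnramifiedIn (𝓞 L) (𝔓.under (𝓞 F)).asIdeal := by
  intro hL
  apply hv₀
  have hw : (𝔓.under (𝓞 F)).under (𝓞 F₀) = v₀ := (under_under_place 𝔓).trans h𝔓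
  have hu : (𝔓.under (𝓞 K)).under (𝓞 F₀) = v₀ := (under_under_place 𝔓).trans h𝔓
  haveI := 𝔓.isPrime
  haveI : 𝔓.asIdeal.LiesOver (𝔓.under (𝓞 F)).asIdeal := ⟨rfl⟩
  haveI : 𝔓.asIdeal.LiesOver (𝔓.under (𝓞 K)).asIdeal := ⟨rfl⟩
  have ht1 : 𝔓.asIdeal.ramificationIdx (𝓞 F₀) =
      (𝔓.under (𝓞 F)).asIdeal.ramificationIdx (𝓞 F₀) * 𝔓.asIdeal.ramificationIdx (𝓞 F) :=
    Ideal.ramificationIdx_tower (𝔓.under (𝓞 F)).asIdeal 𝔓.asIdeal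
  have ht2 : 𝔓.asIdeal.ramificationIdx (𝓞 F₀) =
      (𝔓.under (𝓞 K)).asIdeal.ramificationIdx (𝓞 F₀) * 𝔓.asIdeal.ramificationIdx (𝓞 K) :=
    Ideal.ramificationIdx_tower (𝔓.under (𝓞 K)).asIdeal 𝔓.asIdeal
  rw [hF _ hw, hL.ramificationIdx_eq_one ⟨rfl⟩, one_mul] at ht1
  rw [ht1] at ht2
  have e3 : (𝔓.under (𝓞 K)).asIdeal.ramificationIdx (𝓞 F₀) = 1 := (Nat.eq_one_of_mul_eq_one_right ht2.symm)
  refine isUnramifiedIn_of_forall_ramificationIdx_eq_one v₀ fun u hu' ↦ ?_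
  haveI : u.asIdeal.IsPrime := u.isPrime
  haveI : (𝔓.under (𝓞 K)).asIdeal.IsPrime := (𝔓.under (𝓞 K)).isPrime
  haveI : u.asIdeal.LiesOver v₀.asIdeal := ⟨by rw [← hu']; rfl⟩
  haveI : (𝔓.under (𝓞 K)).asIdeal.LiesOver v₀.asIdeal := ⟨by rw [← hu]; rfl⟩
  haveI : Module.Finite (𝓞 F₀) (𝓞 K) := IsIntegralClosure.finite (𝓞 F₀) F₀ K (𝓞 K)
  haveI : IsGaloisGroup (K ≃ₐ[F₀] K) (𝓞 F₀) (𝓞 K) :=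
    IsGaloisGroup.of_isFractionRing (K ≃ₐ[F₀] K) (𝓞 F₀) (𝓞 K) F₀ K
  rw [← Ideal.ramificationIdxIn_eq_ramificationIdx v₀.asIdeal u.asIdeal (K ≃ₐ[F₀] K),
    Ideal.ramificationIdxIn_eq_ramificationIdx v₀.asIdeal (𝔓.under (𝓞 K)).asIdeal (K ≃ₐ[F₀] K), e3]

end Ramified

section Objects

variable {F₀ F : Type} [Field F₀] [NumberField F₀] [Field F] [NumberField F] [Algebra F₀ F]

/-- **The induced package with a PRESCRIBED avatar character** (as `stub_inducedPackage_of_automorphicInduction`,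
whose avatar `ω` is chosen internally): from the fact `hAI`, for the crux data and ANY finite-order `ω`
carrying the Frobenius values of `eψ`, a cuspidal `Pind` on `GL_{2n}/F₀` with the induced Satake
relation for `π ⊗ ω` at EVERY place of `F₀` unramified in `F` (hence at every guarded place, with the
twisted guard family `(α_w c_w)_w`). [cite: ArthurClozelAMS120, Ch. 3 Thm. 4.2 (e), Thm. 5.1, Lemma 6.4] -/
theorem exists_inducedPackage_avatar (hAI : automorphicInduction_cyclic_cuspidal_unramified)
    {τ : F ≃ₐ[F₀] F} {n : ℕ} {hcpt : isCompact_glFiniteIntegralLevel n F}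
    {π : CuspidalAutomorphicRepData n F hcpt} {e : FramedGaloisRep F₀ ℂ 1} {k : ℤ} {ℓ : ℕ}
    {eψ : FramedGaloisRep F ℂ 1} (hH : Hyps τ n π e k ℓ eψ) {ω : HeckeCharacter F}
    (hfin : ω.IsFiniteOrder)
    (hω : ∀ w : HeightOneSpectrum (𝓞 F), eψ.IsUnramifiedAt w →
      ω.IsUnramifiedAt w ∧ eψ.HasFrobCharpolyAt w (X - C (ω.valueAtUniformizer w))) :
    ∃ Pind : CuspidalAutomorphicRepData (2 * n) F₀ (isCompact_glFiniteIntegralLevel_holds (2 * n) F₀),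
      (∀ (v : HeightOneSpectrum (𝓞 F₀)) (β : HeightOneSpectrum (𝓞 F) → Multiset ℂ),
        Algebra.IsUnramifiedIn (𝓞 F) v.asIdeal →
        (∀ w : HeightOneSpectrum (𝓞 F), w.asIdeal.under (𝓞 F₀) = v.asIdeal →
          (π.twist ω hfin).1.HasSatakeParamAt w (β w)) →
        ∃ B : Multiset ℂ, Pind.1.HasSatakeParamAt v B ∧ satakePolynomial B = inducedSatakePolynomial v β) ∧
      (∀ (v : HeightOneSpectrum (𝓞 F₀)) (α : HeightOneSpectrum (𝓞 F) → Multiset ℂ)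
        (c : HeightOneSpectrum (𝓞 F) → ℂ), Guard π eψ v α c →
        ∃ B : Multiset ℂ, Pind.1.HasSatakeParamAt v B ∧
          satakePolynomial B = inducedSatakePolynomial v (fun w ↦ (α w).map (fun a ↦ a * c w))) ∧
      IsAutomorphicInductionAlong (π.twist ω hfin).1 Pind.1 := by
  -- adapted from Theorems/QuadraticWindowHostInducedRepInducedPackage.lean (`stub_inducedPackage_of_automorphicInduction`)
  have hn : 0 < n := hyps_rank_pos hH
  obtain ⟨-, hdeg, -, -, -, -, -, -, -, -, -, hnti⟩ := hH
  haveI : Algebra.IsQuadraticExtension F₀ F := ⟨hdeg⟩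
  haveI : IsGalois F₀ F := Algebra.IsQuadraticExtension.isGalois F₀ F
  have hcyc : IsCyclic (F ≃ₐ[F₀] F) := Algebra.IsQuadraticExtension.isCyclic F₀ F
  have hprime : (Module.finrank F₀ F).Prime := hdeg ▸ Nat.prime_two
  have hnst := not_isGaloisStableSatakeAE_twist π eψ τ hfin hω hnti
  have key : ∀ N : ℕ, n * Module.finrank F₀ F = N → ∀ hK : isCompact_glFiniteIntegralLevel N F₀,
      ∃ P : CuspidalAutomorphicRepData N F₀ hK,
        ∀ (v : HeightOneSpectrum (𝓞 F₀)) (β : HeightOneSpectrum (𝓞 F) → Multiset ℂ),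
          Algebra.IsUnramifiedIn (𝓞 F) v.asIdeal →
          (∀ w : HeightOneSpectrum (𝓞 F), w.asIdeal.under (𝓞 F₀) = v.asIdeal →
              (π.twist ω hfin).1.HasSatakeParamAt w (β w)) →
            ∃ α : Multiset ℂ, P.1.HasSatakeParamAt v α ∧
              satakePolynomial α = inducedSatakePolynomial v β := by
    rintro N rfl hK
    exact hAI n F₀ F hcyc hprime hn hcpt hK (π.twist ω hfin) hnst
  obtain ⟨P, hP⟩ := key (2 * n) (by rw [hdeg, mul_comm]) (isCompact_glFiniteIntegralLevel_holds (2 * n) F₀)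
  refine ⟨P, hP, fun v α c hg ↦ ?_, ?_⟩
  · have hv : Algebra.IsUnramifiedIn (𝓞 F) v.asIdeal :=
      isUnramifiedIn_of_forall_ramificationIdx_eq_one v fun w hw ↦ (hg w hw).1
    refine hP v (fun w ↦ (α w).map (fun a ↦ a * c w)) hv fun w hw ↦ ?_
    obtain ⟨-, hsat, hunr, hfrob⟩ := hg w ((place_under_eq_iff_asIdeal w v).mpr hw)
    obtain ⟨hωu, hωfrob⟩ := hω w hunr
    have hc : c w = ω.valueAtUniformizer w := artinAvatar_frobValue_unique hfrob hωfrob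
    have e : (α w).map (fun a ↦ a * c w) = (α w).map (ω.valueAtUniformizer w * ·) :=
      Multiset.map_congr rfl fun a _ ↦ by rw [hc, mul_comm]
    rw [e]
    exact hasSatakeParamAt_twist_at_unramified_place hsat hfin hωu
  · have hfinU : ∀ᶠ v : HeightOneSpectrum (𝓞 F₀) in cofinite, Algebra.IsUnramifiedIn (𝓞 F) v.asIdeal := by
      filter_upwards [(finite_setOf_not_isUnramifiedIn F₀ F).compl_mem_cofinite] with v hv
      simpa using hv
    filter_upwards [hfinU] with v hv β hβ
    exact hP v β hv hβ

/-- **The `cK`-admissible set `U` of places of `K`** on which the extension `ψu` of `χ₀` is asked to be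
unramified: the places above the unramified places of `χ₀`, together with ONE chosen place `pick v`
above each `v`, kept only when `cK` moves it.  If `u ∈ U` and `cK • u ∈ U` then `χ₀` is unramified
below `u` (a chosen place is not the conjugate of a chosen place over the same `v`). [folklore] -/
theorem admissible_of_pick {K : Type} [Field K] [NumberField K] [Algebra F₀ K] (cK : K ≃ₐ[F₀] K)
    (χ₀ : HeckeCharacter F₀) (pick : HeightOneSpectrum (𝓞 F₀) → HeightOneSpectrum (𝓞 K)) :
    ∀ u ∈ {u : HeightOneSpectrum (𝓞 K) | χ₀.IsUnramifiedAt (u.under (𝓞 F₀)) ∨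
        (u = pick (u.under (𝓞 F₀)) ∧ cK • u ≠ u)},
      cK • u ∈ {u : HeightOneSpectrum (𝓞 K) | χ₀.IsUnramifiedAt (u.under (𝓞 F₀)) ∨
        (u = pick (u.under (𝓞 F₀)) ∧ cK • u ≠ u)} → χ₀.IsUnramifiedAt (u.under (𝓞 F₀)) := by
  rintro u (hu | ⟨hu, hne⟩) hcu
  · exact hu
  · rcases hcu with hcu | ⟨hcu, -⟩
    · rwa [HeightOneSpectrum.under_algEquiv_smul] at hcu
    · exfalso
      apply hne
      rw [HeightOneSpectrum.under_algEquiv_smul] at hcu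
      rw [hcu, ← hu]

/-- **The member objects and their relations** (`MemberRel`), the unramifiedness of `ψu` above the
unramified places of `χ₀ = (χe ω₀)⁻¹ μ`, and the COVERAGE clause of the dictionary (one place over every
guarded `v` split in `K`).  See the module docstring for the construction.
[cite: ArthurClozelAMS120, Ch. 3 Thm. 4.2, 5.1, 6.2] -/
theorem memberSatake_objects (hAI : automorphicInduction_cyclic_cuspidal_unramified)
    (hBC : ∀ (n : ℕ) (F E : Type) [Field F] [NumberField F] [Field E] [NumberField E] [Algebra F E]
      [IsGalois F E], (Module.finrank F E).Prime →
      ∀ (hF : isCompact_glFiniteIntegralLevel n F) (π : CuspidalAutomorphicRepData n F hF),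
        (∃ v : HeightOneSpectrum (𝓞 F), ¬ Algebra.IsUnramifiedIn (𝓞 E) v.asIdeal ∧ π.1.IsUnramifiedAt v) →
        ∀ (hE : isCompact_glFiniteIntegralLevel n E),
          ∃ P : CuspidalAutomorphicRepData n E hE, IsUnramifiedBaseChangeLift π.1 P.1)
    (hext : ∀ (F₀ K : Type) [Field F₀] [NumberField F₀] [Field K] [NumberField K] [Algebra F₀ K]
      (c : K ≃ₐ[F₀] K), Module.finrank F₀ K = 2 → c ≠ 1 →
      ∀ (χ₀ : HeckeCharacter F₀), χ₀.IsUnitary →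
      ∀ (U : Set (HeightOneSpectrum (𝓞 K))),
        (∀ u ∈ U, c • u ∈ U → χ₀.IsUnramifiedAt (u.under (𝓞 F₀))) →
        ∃ χ : HeckeCharacter K, χ.IsUnitary ∧
          (∀ x, χ (AdeleRing.ideleBaseChange F₀ K x) = χ₀ x) ∧ ∀ u ∈ U, χ.IsUnramifiedAt u)
    (τ : F ≃ₐ[F₀] F) (n : ℕ) (hcpt : isCompact_glFiniteIntegralLevel n F)
    (π : CuspidalAutomorphicRepData n F hcpt) (e : FramedGaloisRep F₀ ℂ 1) (k : ℤ) (ℓ : ℕ) [Fact ℓ.Prime]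
    (ι : PadicAlgCl ℓ ≃+* ℂ) (eψ : FramedGaloisRep F ℂ 1) (hH : Hyps τ n π e k ℓ eψ)
    (K : Type) [Field K] [NumberField K] [Algebra F₀ K] (cK : K ≃ₐ[F₀] K) (h2K : Module.finrank F₀ K = 2)
    (hcK : cK ≠ 1)
    (hram : ∃ v₀ : HeightOneSpectrum (𝓞 F₀), ¬ Algebra.IsUnramifiedIn (𝓞 K) v₀.asIdeal ∧
      ∃ (α : HeightOneSpectrum (𝓞 F) → Multiset ℂ) (c : HeightOneSpectrum (𝓞 F) → ℂ), Guard π eψ v₀ α c)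
    (L F' : Type) [Field L] [NumberField L] [Field F'] [NumberField F'] [Algebra F₀ L] [Algebra F L]
    [Algebra K L] [Algebra F' L] [IsScalarTower F₀ F L] [IsScalarTower F₀ K L] [IsGalois K L]
    (s : L ≃ₐ[F'] L) (hT : IsPaneTower τ cK L F' s) (χe : HeckeCharacter F₀) (ω : HeckeCharacter F)
    (hfin : ω.IsFiniteOrder) (ω₀ : HeckeCharacter F₀)
    (hχe : ∀ v : HeightOneSpectrum (𝓞 F₀), e.IsUnramifiedAt v →
      χe.IsUnramifiedAt v ∧ e.HasFrobCharpolyAt v (X - C (χe.valueAtUniformizer v)))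
    (hχefin : χe.IsFiniteOrder)
    (hω : ∀ w : HeightOneSpectrum (𝓞 F), eψ.IsUnramifiedAt w →
      ω.IsUnramifiedAt w ∧ eψ.HasFrobCharpolyAt w (X - C (ω.valueAtUniformizer w)))
    (hω₀ : ∀ x, ω₀ x = ω (AdeleRing.ideleBaseChange F₀ F x)) (μ : HeckeCharacter F₀) (hμ : MuHyp F K μ) :
    ∃ (ψu νk ν : HeckeCharacter K)
      (Pind : CuspidalAutomorphicRepData (2 * n) F₀ (isCompact_glFiniteIntegralLevel_holds (2 * n) F₀))
      (PiK τ' : CuspidalAutomorphicRepData (2 * n) K (isCompact_glFiniteIntegralLevel_holds (2 * n) K))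
      (P₀ P : CuspidalAutomorphicRepData n L (isCompact_glFiniteIntegralLevel_holds n L)),
      MemberRel π e eψ k μ χe ω hfin ω₀ ψu νk ν Pind PiK τ' P₀ P ∧
      (∀ u : HeightOneSpectrum (𝓞 K), ((χe * ω₀)⁻¹ * μ).IsUnramifiedAt (u.under (𝓞 F₀)) →
        ψu.IsUnramifiedAt u) ∧
      (∀ (v : HeightOneSpectrum (𝓞 F₀)) (α : HeightOneSpectrum (𝓞 F) → Multiset ℂ)
          (c : HeightOneSpectrum (𝓞 F) → ℂ), Guard π eψ v α c →
          (v.asIdeal.primesOver (𝓞 K)).ncard = 2 →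
          ∃ u : HeightOneSpectrum (𝓞 K), u.under (𝓞 F₀) = v ∧ (ψu * νk * ν).IsUnramifiedAt u ∧
            ∃ β : Multiset ℂ, τ'.1.HasSatakeParamAt u β ∧
              arithFrobPolyOfSatake ι u.residueCard (2 * n)
                  (β.map (fun b ↦ b * ((ψu * νk * ν).valueAtUniformizer u)⁻¹)) = hostPoly ι n α c v) := by
  have hn : 0 < n := hyps_rank_pos hH
  haveI : NeZero n := ⟨hn.ne'⟩
  haveI : NeZero (2 * n) := ⟨by omega⟩
  have hdeg : Module.finrank F₀ F = 2 := hH.2.1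
  haveI : Algebra.IsQuadraticExtension F₀ K := ⟨h2K⟩
  haveI : IsGalois F₀ K := Algebra.IsQuadraticExtension.isGalois F₀ K
  haveI : Algebra.IsQuadraticExtension F L := ⟨hT.1⟩
  haveI : IsGalois F L := Algebra.IsQuadraticExtension.isGalois F L
  -- `χ₀` has finite order, hence is unitary
  have hω₀fin : ω₀.IsFiniteOrder := isFiniteOrder_of_restrict hω₀ hfin
  have hχ₀fin : ((χe * ω₀)⁻¹ * μ).IsFiniteOrder := by
    change IsOfFinOrder _
    exact ((IsOfFinOrder.mul hχefin hω₀fin).inv).mul hμ.1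
  have hχ₀u : ((χe * ω₀)⁻¹ * μ).IsUnitary := hχ₀fin.isUnitary
  -- the set `U` and the unitary extension `ψu`
  choose pick hpick using fun v : HeightOneSpectrum (𝓞 F₀) ↦ HeightOneSpectrum.exists_under_eq K v
  obtain ⟨ψu, hψuU, hψures, hψuunr⟩ := hext F₀ K cK h2K hcK _ hχ₀u _
    (admissible_of_pick cK ((χe * ω₀)⁻¹ * μ) pick)
  -- the norm powers
  obtain ⟨νk, hνk⟩ := exists_heckeCharacter_ideleNorm_cpow (K := K) ((k : ℂ) / 2)
  obtain ⟨ν, hν⟩ := exists_heckeCharacter_ideleNorm_cpow (K := K) (-(n : ℂ) / 2)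
  -- the induced package `Pind = AI(π ⊗ ω)`
  obtain ⟨Pind, hPind, hIP, hAIae⟩ := exists_inducedPackage_avatar hAI hH hfin hω
  -- the strong base change `PiK` to `K` (`Pind` is unramified at the ramified guarded `v₀`)
  obtain ⟨v₀, hv₀, α₀, c₀, hg₀⟩ := hram
  obtain ⟨B₀, hB₀, -⟩ := hIP v₀ α₀ c₀ hg₀
  obtain ⟨PiK, hPiK⟩ := hBC (2 * n) F₀ K (h2K ▸ Nat.prime_two) _ Pind ⟨v₀, hv₀, B₀, hB₀⟩
    (isCompact_glFiniteIntegralLevel_holds (2 * n) K)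
  -- the twist `τ' = PiK ⊗ (ψu νk)`
  obtain ⟨τ', hτ'W, hτ'W'⟩ := exists_cuspidalAutomorphicRepData_twist_hecke (ψu * νk) PiK
  -- the strong base change `P₀` of `π ⊗ ω` to `L` (a place of `F` over `v₀` is ramified in `L`)
  obtain ⟨𝔓₀, h𝔓₀⟩ := HeightOneSpectrum.exists_under_eq L v₀
  have hw₀v : (𝔓₀.under (𝓞 F)).under (𝓞 F₀) = v₀ := (under_under_place 𝔓₀).trans h𝔓₀
  have hw₀unr : (π.twist ω hfin).1.IsUnramifiedAt (𝔓₀.under (𝓞 F)) := by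
    obtain ⟨-, hsat, hunr, -⟩ := hg₀ _ hw₀v
    exact ⟨_, hasSatakeParamAt_twist_at_unramified_place hsat hfin (hω _ hunr).1⟩
  have hw₀ram : ¬ Algebra.IsUnramifiedIn (𝓞 L) (𝔓₀.under (𝓞 F)).asIdeal :=
    not_isUnramifiedIn_under_of_tower 𝔓₀ h𝔓₀ hv₀ fun w hw ↦ (hg₀ w hw).1
  obtain ⟨P₀, hP₀⟩ := hBC n F L (hT.1 ▸ Nat.prime_two) hcpt (π.twist ω hfin)
    ⟨_, hw₀ram, hw₀unr⟩ (isCompact_glFiniteIntegralLevel_holds n L)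
  -- the twist `P = P₀ ⊗ ((ψu νk) ∘ N_{L/K})`
  obtain ⟨P, hPW, hPW'⟩ :=
    exists_cuspidalAutomorphicRepData_twist_hecke ((ψu * νk).compRelNorm L) P₀
  refine ⟨ψu, νk, ν, Pind, PiK, τ', P₀, P, ⟨hχe, hχefin, hω, hω₀, hχ₀fin, hψuU, hψures, hνk, hν, hAIae,
    hPiK.isWeakBaseChangeLiftAE, hτ'W, hτ'W', hP₀.isWeakBaseChangeLiftAE, hPW, hPW'⟩,
    fun u hu ↦ hψuunr u (Or.inl hu), fun v α c hg hsplit ↦ ?_⟩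
  -- COVERAGE at the chosen place `u = pick v` over a guarded `v` split in `K`
  have hef := ramificationIdx_inertiaDeg_eq_one_of_ncard v (hsplit.trans h2K.symm)
  have hvK : Algebra.IsUnramifiedIn (𝓞 K) v.asIdeal :=
    isUnramifiedIn_of_forall_ramificationIdx_eq_one v fun u hu ↦ (hef u hu).1
  have hne : cK • pick v ≠ pick v := by
    refine smul_ne_of_ncard_eq_two (K := F₀) (E := K) (v := v) ?_ hcK (hpick v)
    rw [ncard_finitePlacesOver_eq_ncard_primesOver, hsplit]
  have hmem : pick v ∈ {u : HeightOneSpectrum (𝓞 K) | ((χe * ω₀)⁻¹ * μ).IsUnramifiedAt (u.under (𝓞 F₀)) ∨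
      (u = pick (u.under (𝓞 F₀)) ∧ cK • u ≠ u)} := Or.inr ⟨by rw [hpick v], hne⟩
  have hψ₀u : (ψu * νk).IsUnramifiedAt (pick v) :=
    parity_isUnramifiedAt_mul (hψuunr _ hmem) (HeckeCharacter.IsNormTwist.isUnramifiedAt_holds ⟨_, hνk⟩ _)
  obtain ⟨B, hB, hBi⟩ := hIP v α c hg
  exact ⟨pick v, hpick v, member_dictionary_split ι n Pind.1 PiK.1 τ'.1 (ψu * νk) ν hν hτ'W hτ'W'
    hPiK (hpick v) hvK (hef _ (hpick v)).2 hB hBi hψ₀u⟩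

end Objects

/-- **Registered anchor** of this helper file (stub registry of stmt-Langlands-10902, line
`one-transparent-pane`, helper "Objects" for `stub_memberSatake`): the `cK`-admissibility of the set
of places on which the extended character is asked to be unramified. [folklore] -/
theorem memberSatakeObjects_anchor : ∀ (F₀ K : Type) [Field F₀] [NumberField F₀] [Field K] [NumberField K] [Algebra F₀ K] (cK : K ≃ₐ[F₀] K) (χ₀ : HeckeCharacter F₀) (pick : HeightOneSpectrum (𝓞 F₀) → HeightOneSpectrum (𝓞 K)), ∀ u ∈ {u : HeightOneSpectrum (𝓞 K) | χ₀.IsUnramifiedAt (u.under (𝓞 F₀)) ∨ (u = pick (u.under (𝓞 F₀)) ∧ cK • u ≠ u)}, cK • u ∈ {u : HeightOneSpectrum (𝓞 K) | χ₀.IsUnramifiedAt (u.under (𝓞 F₀)) ∨ (u = pick (u.under (𝓞 F₀)) ∧ cK • u ≠ u)} → χ₀.IsUnramifiedAt (u.under (𝓞 F₀)) :=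
  fun _ _ _ _ _ _ _ cK χ₀ pick ↦ admissible_of_pick cK χ₀ pick

end Summit.Langlands.Langlands.Theorems.HostInducedRep.OneTransparentPane

end
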